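import Literature.Analysis.Complex.StripFourierDecay
import Literature.Analysis.Complex.StripResidueFormula
import Literature.Analysis.Complex.VitaliConvergence
import Literature.Analysis.Complex.HolomorphicParametricIntegral
import Mathlib.Analysis.Fourier.Inversion
import Mathlib.Analysis.Complex.PhragmenLindelof
import Mathlib.Analysis.Complex.ReImTopology
import Mathlib.Analysis.Complex.Convex
import HarnessLib

/-!
# The bounded cross theorem for two strips

Analysis/Complex support file (everything proved; theorems only, no definitions, no named facts).
Let `S_b = {|Im z| < b}` and let `F : ℝ × ℝ → ℂ` be a function of two real variables such that

* for every real `y`, `x ↦ F(x, y)` is the restriction of a function `g_y` holomorphic on `S_b`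
  with `‖g_y‖ ≤ M`, and
* for every real `x`, `y ↦ F(x, y)` is the restriction of a function `h_x` holomorphic on `S_b`
  with `‖h_x‖ ≤ M`.

Then `F` is the restriction to `ℝ²` of ONE function `G` holomorphic on the diamond tube
`{(z, w) | |Im z| + |Im w| < b}` with `‖G‖ ≤ M` there
(`exists_holomorphic_extension_diamond_of_separately`). This is the classical **cross theorem**
(S. N. Bernstein 1912 for ellipses, J. Siciak 1969, V. P. Zahariuta 1976; M. Jarnicki, P. Pflug,
*Separately Analytic Functions*, EMS 2011, Ch. 5) for the cross `(S_b × ℝ) ∪ (ℝ × S_b)`, whose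
envelope `{h(z) + h(w) < 1}` is computed from the relative extremal function `h(z) = |Im z|/b` of
`ℝ` in `S_b`, together with the two-constants estimate `‖G‖ ≤ M`. No joint regularity of `F` is
assumed.

## Proof (one variable at a time, by Fourier analysis)

1. *Parameter continuity for free* (`continuous_apply_of_continuous_ofReal`): `x ↦ h_x(w)` is
   continuous for every `w ∈ S_b` — along `xₙ → x₀` the bounded sequence `h_{xₙ}` converges on `ℝ`
   (`h_{xₙ}(y) = g_y(xₙ) → g_y(x₀)`), hence locally uniformly on `S_b` by Vitali's theorem
   (`Literature.Analysis.Complex.exists_tendstoLocallyUniformlyOn_of_frequently_tendsto`), to a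
   limit which is `h_{x₀}` by the identity theorem.
2. *The partial Fourier transform* `Ψ(ξ, w) = 𝓕(x ↦ h_x(w) e^{-εx²})(ξ)` is holomorphic in
   `w ∈ S_b` (dominated holomorphic parameter integral,
   `Literature.Analysis.Complex.differentiableOn_integral_of_dominated`), bounded by `J M`
   (`J = ∫ e^{-εx²}`), and on the real axis `Ψ(ξ, y) = 𝓕(g_y e^{-ε·²})(ξ)` decays like
   `e^{-2πc|ξ|}` for every `c < b` (Paley–Wiener on the strip,
   `Literature.Analysis.Complex.norm_fourier_mul_gaussian_le_of_strip`).
3. *Two constants* (`norm_le_mul_exp_of_strip`, Phragmén–Lindelöf for `Ψ e^{2π|ξ|(c ± iw)}`):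
   `‖Ψ(ξ, w)‖ ≤ A M e^{-2π|ξ|(b - |Im w|)}` on the whole strip.
4. *Fourier–Laplace synthesis*: `G(z, w) = e^{εz²} ∫ e^{2πiξz} Ψ(ξ, w) dξ` converges absolutely and
   is jointly holomorphic exactly on the diamond `|Im z| + |Im w| < b` (dominated parameter
   integral on `ℂ × ℂ`), restricts to `F` on `ℝ²` (Fourier inversion in one variable), and obeys
   `‖G(p)‖ ≤ C(p) M` with `C(p)` independent of `F` (`exists_extension_diamond_aux`).
5. *The sharp bound by the power trick*: the same construction for `F^N` yields, by uniqueness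
   of the extension (`eqOn_diamond_of_forall_ofReal`), the function `G^N`, so
   `‖G(p)‖^N ≤ C(p) M^N` for all `N` and `‖G(p)‖ ≤ M`.

## References

* M. Jarnicki, P. Pflug, *Separately Analytic Functions*, EMS Tracts in Mathematics 16 (2011),
  Ch. 5 (the classical cross theorem). [JarnickiPflug2011]
* S. N. Bernstein, *Sur l'ordre de la meilleure approximation des fonctions continues par des
  polynômes de degré donné*, Mém. Acad. Roy. Belgique (1912); J. Siciak, Ann. Polon. Math. 22
  (1969) 145–171.

## Mathlib / tree

Mathlib: `PhragmenLindelof.horizontal_strip`, `Continuous.fourierInv_fourier_eq` (Fourier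
inversion), `VectorFourier.fourierIntegral_continuous`, `AnalyticOnNhd.eqOn_of_preconnected_of_frequently_eq`.
Mathlib has no statement about separately holomorphic functions (searched `separately`,
`Hartogs`, `cross theorem`). Tree: `StripFourierDecay`, `VitaliConvergence`,
`HolomorphicParametricIntegral`, `StripResidueFormula` (`integrable_exp_neg_mul_abs`).
-/

noncomputable section

open _root_.Complex Set MeasureTheory Filter Metric Real
open scoped _root_.Topology FourierTransform

namespace Literature.Analysis.Complex

variable {b : ℝ}

/-! ### The strip and the identity theorem from the real axis -/

/-- The open horizontal strip `{|Im z| < b}` is open. [folklore] -/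
theorem isOpen_setOf_abs_im_lt (b : ℝ) : IsOpen {z : ℂ | |z.im| < b} :=
  isOpen_lt (continuous_abs.comp Complex.continuous_im) continuous_const

/-- The open horizontal strip `{|Im z| < b}` is preconnected (it is convex). [folklore] -/
theorem isPreconnected_setOf_abs_im_lt (b : ℝ) : IsPreconnected {z : ℂ | |z.im| < b} := by
  have h : {z : ℂ | |z.im| < b} = {z : ℂ | z.im < b} ∩ {z : ℂ | -b < z.im} := by
    ext z; simp only [mem_setOf_eq, mem_inter_iff, abs_lt]; tauto
  rw [h]
  exact ((convex_halfSpace_im_lt b).inter (convex_halfSpace_im_gt (-b))).isPreconnected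

/-- Real points lie in the strip `{|Im z| < b}` when `b > 0`. [folklore] -/
theorem ofReal_mem_setOf_abs_im_lt (hb : 0 < b) (x : ℝ) : (x : ℂ) ∈ {z : ℂ | |z.im| < b} := by
  simpa using hb

/-- A property holding at all real points holds frequently in the punctured neighbourhood of
`0 ∈ ℂ` (the real axis accumulates at `0`). [folklore] -/
theorem frequently_nhdsNE_zero_of_forall_ofReal {P : ℂ → Prop} (h : ∀ x : ℝ, P x) :
    ∃ᶠ z in 𝓝[≠] (0 : ℂ), P z := by
  have htend : Tendsto (fun t : ℝ => (t : ℂ)) (𝓝[≠] 0) (𝓝[≠] ((0 : ℝ) : ℂ)) := by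
    refine tendsto_nhdsWithin_of_tendsto_nhds_of_eventually_within _
      (Complex.continuous_ofReal.continuousAt.mono_left nhdsWithin_le_nhds) ?_
    filter_upwards [self_mem_nhdsWithin] with t ht
    simpa using ht
  have hev : ∀ᶠ t : ℝ in 𝓝[≠] 0, P t := Eventually.of_forall h
  simpa using htend.frequently hev.frequently

/-- **Identity theorem on a strip from the real axis**: two functions holomorphic on
`{|Im z| < b}` which agree at all real points agree on the strip. [folklore] -/
theorem eqOn_setOf_abs_im_lt_of_forall_ofReal {f g : ℂ → ℂ} (hb : 0 < b)
    (hf : DifferentiableOn ℂ f {z : ℂ | |z.im| < b})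
    (hg : DifferentiableOn ℂ g {z : ℂ | |z.im| < b}) (hfg : ∀ t : ℝ, f t = g t) :
    EqOn f g {z : ℂ | |z.im| < b} :=
  (hf.analyticOnNhd (isOpen_setOf_abs_im_lt b)).eqOn_of_preconnected_of_frequently_eq
    (hg.analyticOnNhd (isOpen_setOf_abs_im_lt b)) (isPreconnected_setOf_abs_im_lt b)
    (show (0 : ℂ) ∈ {z : ℂ | |z.im| < b} by simpa using hb)
    (frequently_nhdsNE_zero_of_forall_ofReal hfg)

/-! ### Parameter continuity of a bounded holomorphic family pinned on the real axis -/

/-- **Continuity in the parameter comes for free.** Let `H x` (`x ∈ ℝ`) be holomorphic on the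
strip `{|Im w| < b}` and bounded there by `M` uniformly in `x`, and suppose that at every *real*
point `y` the value `H x y` depends continuously on `x`. Then `H x w` depends continuously on `x`
at every point `w` of the strip: along `xₙ → x₀` the bounded sequence `H xₙ` converges on `ℝ`,
hence (Vitali) locally uniformly on the strip, and the limit is `H x₀` by the identity theorem.
[folklore] -/
theorem continuous_apply_of_continuous_ofReal (hb : 0 < b) {H : ℝ → ℂ → ℂ} {M : ℝ}
    (hd : ∀ x, DifferentiableOn ℂ (H x) {w : ℂ | |w.im| < b})
    (hM : ∀ x, ∀ w : ℂ, |w.im| < b → ‖H x w‖ ≤ M)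
    (hc : ∀ y : ℝ, Continuous fun x => H x y) {w : ℂ} (hw : |w.im| < b) :
    Continuous fun x => H x w := by
  refine continuous_iff_continuousAt.2 fun x₀ => ?_
  rw [ContinuousAt, tendsto_iff_seq_tendsto]
  intro u hu
  have hpt : ∀ t : ℝ, Tendsto (fun n => H (u n) t) atTop (𝓝 (H x₀ t)) := fun t =>
    ((hc t).tendsto x₀).comp hu
  obtain ⟨f, hf, hlim⟩ := exists_tendstoLocallyUniformlyOn_of_frequently_tendsto
    (isOpen_setOf_abs_im_lt b) (isPreconnected_setOf_abs_im_lt b) (F := fun n => H (u n))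
    (fun n => hd _) (fun a _ => ⟨M, 1, one_pos, fun n z hz => hM _ z hz.2⟩)
    (show (0 : ℂ) ∈ {z : ℂ | |z.im| < b} by simpa using hb)
    (frequently_nhdsNE_zero_of_forall_ofReal fun t => ⟨H x₀ t, hpt t⟩)
  have hfeq : EqOn f (H x₀) {z : ℂ | |z.im| < b} := by
    refine eqOn_setOf_abs_im_lt_of_forall_ofReal hb hf (hd x₀) fun t => ?_
    exact tendsto_nhds_unique (hlim.tendsto_at (ofReal_mem_setOf_abs_im_lt hb t)) (hpt t)
  have h := hlim.tendsto_at (show w ∈ {z : ℂ | |z.im| < b} from hw)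
  rw [hfeq (show w ∈ {z : ℂ | |z.im| < b} from hw)] at h
  exact h

/-! ### Elementary estimates -/

/-- `‖e^{-εx²}‖ = e^{-εx²}` for real `ε, x`. [folklore] -/
theorem norm_cexp_neg_mul_sq (ε x : ℝ) :
    ‖Complex.exp (-(ε : ℂ) * (x : ℂ) ^ 2)‖ = Real.exp (-ε * x ^ 2) := by
  rw [show -(ε : ℂ) * (x : ℂ) ^ 2 = ((-ε * x ^ 2 : ℝ) : ℂ) by push_cast; ring, Complex.norm_exp,
    Complex.ofReal_re]

/-- Undoing the Gaussian damping: `e^{εx²} (u e^{-εx²}) = u`. [folklore] -/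
theorem cexp_mul_sq_mul_mul_cexp_neg (ε : ℝ) (x u : ℂ) :
    Complex.exp ((ε : ℂ) * x ^ 2) * (u * Complex.exp (-(ε : ℂ) * x ^ 2)) = u := by
  rw [mul_left_comm, ← mul_assoc u, mul_assoc, ← Complex.exp_add,
    show (ε : ℂ) * x ^ 2 + -(ε : ℂ) * x ^ 2 = 0 by ring, Complex.exp_zero, mul_one]

/-- The modulus of the Fourier–Laplace kernel: `‖e^{2πiξz}‖ = e^{-2πξ Im z}`. [folklore] -/
theorem norm_cexp_two_pi_mul_mul_I (ξ : ℝ) (z : ℂ) :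
    ‖Complex.exp (2 * π * ξ * z * I)‖ = Real.exp (-(2 * π * ξ * z.im)) := by
  rw [Complex.norm_exp]
  congr 1
  simp only [mul_re, mul_im, I_re, I_im, ofReal_re, ofReal_im, re_ofNat, im_ofNat, mul_zero,
    sub_zero, zero_mul, add_zero, mul_one]
  ring

/-- `‖e^{2πiξz}‖ ≤ e^{2π|ξ||Im z|}`. [folklore] -/
theorem norm_cexp_two_pi_mul_mul_I_le (ξ : ℝ) (z : ℂ) :
    ‖Complex.exp (2 * π * ξ * z * I)‖ ≤ Real.exp (2 * π * |ξ| * |z.im|) := by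
  rw [norm_cexp_two_pi_mul_mul_I]
  refine Real.exp_le_exp.2 ?_
  have h : -(ξ * z.im) ≤ |ξ| * |z.im| := by
    rw [← abs_mul]; exact neg_le_abs (ξ * z.im)
  nlinarith [Real.pi_pos, h]

/-- In the product `ℂ × ℂ` (sup distance), the imaginary parts of the coordinates of a point of
`ball p₀ r` differ from those of `p₀` by less than `r`. [folklore] -/
theorem abs_im_lt_of_mem_ball {p p₀ : ℂ × ℂ} {r : ℝ} (hp : p ∈ ball p₀ r) :
    |p.1.im| < |p₀.1.im| + r ∧ |p.2.im| < |p₀.2.im| + r := by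
  rw [mem_ball, Prod.dist_eq, max_lt_iff, dist_eq_norm, dist_eq_norm] at hp
  have h1 := Complex.abs_im_le_norm (p.1 - p₀.1)
  have h2 := Complex.abs_im_le_norm (p.2 - p₀.2)
  rw [Complex.sub_im] at h1 h2
  have h1' := abs_sub_abs_le_abs_sub p.1.im p₀.1.im
  have h2' := abs_sub_abs_le_abs_sub p.2.im p₀.2.im
  constructor <;> linarith [hp.1, hp.2]

/-- Passing to the limit `c → b⁻` in a bound valid for all `c ∈ (a, b)`. [folklore] -/
theorem le_mul_exp_of_forall_lt {a K ℓ r : ℝ} (hab : a < b)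
    (h : ∀ c, a < c → c < b → r ≤ K * Real.exp (-ℓ * (c - a))) :
    r ≤ K * Real.exp (-ℓ * (b - a)) := by
  have hcont : Tendsto (fun c : ℝ => K * Real.exp (-ℓ * (c - a))) (𝓝[<] b)
      (𝓝 (K * Real.exp (-ℓ * (b - a)))) :=
    ((by fun_prop : Continuous fun c : ℝ => K * Real.exp (-ℓ * (c - a))).tendsto b).mono_left
      nhdsWithin_le_nhds
  refine ge_of_tendsto hcont ?_
  filter_upwards [Ioo_mem_nhdsLT hab] with c hc using h c hc.1 hc.2

/-! ### Two-constants estimate on a strip (Phragmén–Lindelöf) -/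

/-- Two-constants estimate, upper half: if `u` is holomorphic and bounded by `K` on
`{|Im z| < b}` and `‖u(t)‖ ≤ K e^{-ℓc}` on the real axis (`ℓ ≥ 0`, `0 < c < b`), then
`‖u(w)‖ ≤ K e^{-ℓ(c - Im w)}` for `0 ≤ Im w ≤ c` (Phragmén–Lindelöf for `u(w) e^{ℓ(c + iw)}` on the
strip `0 < Im w < c`). [folklore] -/
theorem norm_le_mul_exp_of_strip_of_im_nonneg {u : ℂ → ℂ} {K ℓ c : ℝ} (hc : 0 < c) (hcb : c < b)
    (hℓ : 0 ≤ ℓ) (hu : DifferentiableOn ℂ u {z : ℂ | |z.im| < b})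
    (hK : ∀ z : ℂ, |z.im| < b → ‖u z‖ ≤ K) (hreal : ∀ t : ℝ, ‖u t‖ ≤ K * Real.exp (-ℓ * c))
    {w : ℂ} (hw0 : 0 ≤ w.im) (hwc : w.im ≤ c) :
    ‖u w‖ ≤ K * Real.exp (-ℓ * (c - w.im)) := by
  -- the auxiliary function `v(z) = u(z) e^{ℓ(c + iz)}`, `‖v(z)‖ = ‖u(z)‖ e^{ℓ(c - Im z)}`
  set v : ℂ → ℂ := fun z => u z * Complex.exp ((ℓ : ℂ) * ((c : ℂ) + I * z)) with hv
  have hnorm : ∀ z : ℂ, ‖v z‖ = ‖u z‖ * Real.exp (ℓ * (c - z.im)) := by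
    intro z
    rw [hv, norm_mul, Complex.norm_exp]
    congr 2
    simp only [mul_re, add_re, add_im, ofReal_re, ofReal_im, I_re, I_im, mul_im, zero_mul,
      one_mul, zero_sub, sub_zero, zero_add]
    ring
  have hK0 : 0 ≤ K := (norm_nonneg _).trans (hK 0 (by simpa using hc.trans hcb))
  have hstrip : ∀ z : ℂ, z ∈ im ⁻¹' Icc 0 c → |z.im| < b := fun z hz => by
    rw [abs_of_nonneg hz.1]; exact hz.2.trans_lt hcb
  -- Phragmén–Lindelöf on the strip `0 < Im z < c`
  have hPL : ‖v w‖ ≤ K := by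
    refine PhragmenLindelof.horizontal_strip (a := 0) (b := c) ?_ ⟨0, ?_, 0, ?_⟩ ?_ ?_ hw0 hwc
    · refine DifferentiableOn.diffContOnCl ?_
      rw [closure_preimage_im, closure_Ioo hc.ne]
      exact (hu.mono fun z hz => hstrip z hz).mul (by fun_prop)
    · rw [sub_zero]; exact div_pos Real.pi_pos hc
    · refine Asymptotics.IsBigO.of_bound (max (K * Real.exp (ℓ * c)) 0)
        (eventually_inf_principal.2 (Eventually.of_forall fun z hz => ?_))
      have hzb : |z.im| < b := hstrip z ⟨hz.1.le, hz.2.le⟩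
      have : ‖v z‖ ≤ max (K * Real.exp (ℓ * c)) 0 := by
        rw [hnorm]
        refine (mul_le_mul (hK z hzb) (Real.exp_le_exp.2 ?_) (Real.exp_pos _).le hK0).trans
          (le_max_left _ _)
        nlinarith [hz.1]
      simpa using this
    · intro z hz
      have hzre : ((z.re : ℝ) : ℂ) = z := Complex.ext (by simp) (by simp [hz])
      rw [hnorm, hz, sub_zero, ← hzre]
      calc ‖u (z.re : ℂ)‖ * Real.exp (ℓ * c) ≤ K * Real.exp (-ℓ * c) * Real.exp (ℓ * c) := by
            gcongr; exact hreal z.re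
        _ = K := by rw [mul_assoc, ← Real.exp_add, show -ℓ * c + ℓ * c = 0 by ring,
            Real.exp_zero, mul_one]
    · intro z hz
      rw [hnorm, hz, sub_self, mul_zero, Real.exp_zero, mul_one]
      exact hK z (by rw [hz, abs_of_pos hc]; exact hcb)
  rw [hnorm] at hPL
  calc ‖u w‖ = ‖u w‖ * Real.exp (ℓ * (c - w.im)) * Real.exp (-ℓ * (c - w.im)) := by
        rw [mul_assoc, ← Real.exp_add, show ℓ * (c - w.im) + -ℓ * (c - w.im) = 0 by ring,
          Real.exp_zero, mul_one]
    _ ≤ K * Real.exp (-ℓ * (c - w.im)) := by gcongr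

/-- **Two-constants estimate on a strip.** If `u` is holomorphic and bounded by `K` on
`{|Im z| < b}` and `‖u(t)‖ ≤ K e^{-ℓc}` on the real axis (`ℓ ≥ 0`, `0 < c < b`), then
`‖u(w)‖ ≤ K e^{-ℓ(c - |Im w|)}` for `|Im w| ≤ c` (the lower half by `w ↦ -w`). This is the
subharmonicity of `log ‖u‖` against the relative extremal function `|Im w|/c` of `ℝ` in the strip.
[folklore] -/
theorem norm_le_mul_exp_of_strip {u : ℂ → ℂ} {K ℓ c : ℝ} (hc : 0 < c) (hcb : c < b)
    (hℓ : 0 ≤ ℓ) (hu : DifferentiableOn ℂ u {z : ℂ | |z.im| < b})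
    (hK : ∀ z : ℂ, |z.im| < b → ‖u z‖ ≤ K) (hreal : ∀ t : ℝ, ‖u t‖ ≤ K * Real.exp (-ℓ * c))
    {w : ℂ} (hw : |w.im| ≤ c) : ‖u w‖ ≤ K * Real.exp (-ℓ * (c - |w.im|)) := by
  rcases le_or_gt 0 w.im with hw0 | hw0
  · rw [abs_of_nonneg hw0]
    exact norm_le_mul_exp_of_strip_of_im_nonneg hc hcb hℓ hu hK hreal hw0
      ((le_abs_self _).trans hw)
  · -- apply the upper-half estimate to `z ↦ u (-z)` at `-w`
    have hu' : DifferentiableOn ℂ (fun z => u (-z)) {z : ℂ | |z.im| < b} :=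
      hu.comp (differentiableOn_neg _) fun z hz => by simpa using hz
    have hK' : ∀ z : ℂ, |z.im| < b → ‖u (-z)‖ ≤ K := fun z hz => hK (-z) (by simpa using hz)
    have hreal' : ∀ t : ℝ, ‖u (-(t : ℂ))‖ ≤ K * Real.exp (-ℓ * c) := fun t => by
      simpa using hreal (-t)
    have h := norm_le_mul_exp_of_strip_of_im_nonneg hc hcb hℓ hu' hK' hreal' (w := -w)
      (by simpa using hw0.le) (by simpa using (neg_le_abs w.im).trans hw)
    simpa [abs_of_neg hw0] using h

/-! ### The partial Fourier transform `Ψ(ξ, w) = 𝓕(x ↦ H x w · e^{-εx²})(ξ)` -/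

section PartialFourier

variable {ε M : ℝ} {H : ℝ → ℂ → ℂ}

/-- The damped slice `x ↦ H x w · e^{-εx²}` is dominated by `M e^{-εx²}`. [folklore] -/
theorem norm_mul_cexp_neg_mul_sq_le {x : ℝ} {w : ℂ} (hHM : ‖H x w‖ ≤ M) (ε : ℝ) :
    ‖H x w * Complex.exp (-(ε : ℂ) * (x : ℂ) ^ 2)‖ ≤ M * Real.exp (-ε * x ^ 2) := by
  rw [norm_mul, norm_cexp_neg_mul_sq]
  gcongr

/-- The damped slice `x ↦ H x w · e^{-εx²}` is integrable when `x ↦ H x w` is continuous and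
bounded. [folklore] -/
theorem integrable_mul_cexp_neg_mul_sq (hε : 0 < ε) {w : ℂ} (hcont : Continuous fun x => H x w)
    (hHM : ∀ x, ‖H x w‖ ≤ M) :
    Integrable fun x : ℝ => H x w * Complex.exp (-(ε : ℂ) * (x : ℂ) ^ 2) := by
  refine Integrable.mono' ((integrable_exp_neg_mul_sq hε).const_mul M)
    (hcont.mul (by fun_prop)).aestronglyMeasurable (Eventually.of_forall fun x => ?_)
  exact norm_mul_cexp_neg_mul_sq_le (hHM x) ε

/-- **Sup bound**: `‖Ψ(ξ, w)‖ ≤ M ∫ e^{-εx²}` on the strip. [folklore] -/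
theorem norm_fourier_slice_le (hε : 0 < ε) {w : ℂ} (hHM : ∀ x, ‖H x w‖ ≤ M) (ξ : ℝ) :
    ‖𝓕 (fun x : ℝ => H x w * Complex.exp (-(ε : ℂ) * (x : ℂ) ^ 2)) ξ‖ ≤
      M * ∫ x : ℝ, Real.exp (-ε * x ^ 2) := by
  rw [Real.fourier_real_eq_integral_exp_smul, ← integral_const_mul]
  refine norm_integral_le_of_norm_le ((integrable_exp_neg_mul_sq hε).const_mul M)
    (Eventually.of_forall fun x => ?_)
  rw [norm_smul, Complex.norm_exp_ofReal_mul_I, one_mul]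
  exact norm_mul_cexp_neg_mul_sq_le (hHM x) ε

/-- **Holomorphy in the transverse variable**: `w ↦ Ψ(ξ, w)` is holomorphic on the strip
(dominated holomorphic parameter integral; the slices `x ↦ H x w` are continuous). [folklore] -/
theorem differentiableOn_fourier_slice (hε : 0 < ε)
    (hHd : ∀ x, DifferentiableOn ℂ (H x) {w : ℂ | |w.im| < b})
    (hHM : ∀ x (w : ℂ), |w.im| < b → ‖H x w‖ ≤ M)
    (hHc : ∀ w : ℂ, |w.im| < b → Continuous fun x => H x w) (ξ : ℝ) :
    DifferentiableOn ℂ (fun w => 𝓕 (fun x : ℝ => H x w * Complex.exp (-(ε : ℂ) * (x : ℂ) ^ 2)) ξ)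
      {w : ℂ | |w.im| < b} := by
  have hrw : (fun w => 𝓕 (fun x : ℝ => H x w * Complex.exp (-(ε : ℂ) * (x : ℂ) ^ 2)) ξ) =
      fun w => ∫ x : ℝ, Complex.exp (↑(-2 * π * x * ξ) * I) •
        (H x w * Complex.exp (-(ε : ℂ) * (x : ℂ) ^ 2)) := by
    funext w; rw [Real.fourier_real_eq_integral_exp_smul]
  rw [hrw]
  refine differentiableOn_integral_of_dominated (fun w hw => ?_) (Eventually.of_forall fun x => ?_)
    (fun w₀ hw₀ => ?_)
  · exact ((by fun_prop : Continuous fun x : ℝ => Complex.exp (↑(-2 * π * x * ξ) * I)).smul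
      ((hHc w hw).mul (by fun_prop))).aestronglyMeasurable
  · exact ((hHd x).mul (differentiableOn_const _)).const_smul
      (Complex.exp (↑(-2 * π * x * ξ) * I))
  · obtain ⟨R, hR, hRS⟩ := Metric.isOpen_iff.1 (isOpen_setOf_abs_im_lt b) w₀ hw₀
    refine ⟨R, hR, hRS, fun x => M * Real.exp (-ε * x ^ 2), (integrable_exp_neg_mul_sq hε).const_mul M,
      Eventually.of_forall fun x w hw => ?_⟩
    rw [norm_smul, Complex.norm_exp_ofReal_mul_I, one_mul]
    exact norm_mul_cexp_neg_mul_sq_le (hHM x w (hRS hw)) ε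

/-- **Continuity in the frequency**: `ξ ↦ Ψ(ξ, w)` is continuous (Fourier transform of an
integrable function). [folklore] -/
theorem continuous_fourier_slice (hε : 0 < ε) {w : ℂ} (hcont : Continuous fun x => H x w)
    (hHM : ∀ x, ‖H x w‖ ≤ M) :
    Continuous fun ξ : ℝ => 𝓕 (fun x : ℝ => H x w * Complex.exp (-(ε : ℂ) * (x : ℂ) ^ 2)) ξ :=
  VectorFourier.fourierIntegral_continuous Real.continuous_fourierChar (by exact continuous_inner)
    (integrable_mul_cexp_neg_mul_sq hε hcont hHM)

/-- **Exponential decay of `Ψ(ξ, ·)` on the whole strip.** If moreover each real slice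
`x ↦ H x y` is the restriction of a function `G y` holomorphic and bounded by `M` on the strip,
then `‖Ψ(ξ, w)‖ ≤ e^{εb²} (∫ e^{-εx²}) M e^{-2π|ξ|(b - |Im w|)}` for `|Im w| < b`: on the real axis
this is the Paley–Wiener decay of `𝓕(G_y e^{-ε·²})`, inside the strip the two-constants estimate,
and `c → b⁻`. [folklore] -/
theorem norm_fourier_slice_le_exp (hb : 0 < b) (hε : 0 < ε) (hM : 0 ≤ M)
    (hHd : ∀ x, DifferentiableOn ℂ (H x) {w : ℂ | |w.im| < b})
    (hHM : ∀ x (w : ℂ), |w.im| < b → ‖H x w‖ ≤ M)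
    (hHc : ∀ w : ℂ, |w.im| < b → Continuous fun x => H x w)
    {G : ℝ → ℂ → ℂ} (hGd : ∀ y, DifferentiableOn ℂ (G y) {z : ℂ | |z.im| < b})
    (hGM : ∀ y (z : ℂ), |z.im| < b → ‖G y z‖ ≤ M) (hGH : ∀ x y : ℝ, G y x = H x y)
    (ξ : ℝ) {w : ℂ} (hw : |w.im| < b) :
    ‖𝓕 (fun x : ℝ => H x w * Complex.exp (-(ε : ℂ) * (x : ℂ) ^ 2)) ξ‖ ≤
      (Real.exp (ε * b ^ 2) * ∫ x : ℝ, Real.exp (-ε * x ^ 2)) * M *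
        Real.exp (-(2 * π * |ξ|) * (b - |w.im|)) := by
  set J : ℝ := ∫ x : ℝ, Real.exp (-ε * x ^ 2) with hJ
  set K : ℝ := Real.exp (ε * b ^ 2) * J * M with hK
  set u : ℂ → ℂ := fun w => 𝓕 (fun x : ℝ => H x w * Complex.exp (-(ε : ℂ) * (x : ℂ) ^ 2)) ξ
    with hu
  have hJ0 : 0 ≤ J := integral_nonneg fun x => (Real.exp_pos _).le
  have hu_diff : DifferentiableOn ℂ u {z : ℂ | |z.im| < b} :=
    differentiableOn_fourier_slice hε hHd hHM hHc ξ
  have hu_bdd : ∀ z : ℂ, |z.im| < b → ‖u z‖ ≤ K := fun z hz => by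
    calc ‖u z‖ ≤ M * J := norm_fourier_slice_le hε (fun x => hHM x z hz) ξ
      _ = 1 * J * M := by ring
      _ ≤ Real.exp (ε * b ^ 2) * J * M := by
          gcongr; exact Real.one_le_exp (by positivity)
  -- the two-constants estimate for every `c ∈ (|Im w|, b)`
  have hc : ∀ c, |w.im| < c → c < b → ‖u w‖ ≤ K * Real.exp (-(2 * π * |ξ|) * (c - |w.im|)) := by
    intro c hwc hcb
    have hc0 : 0 < c := (abs_nonneg _).trans_lt hwc
    refine norm_le_mul_exp_of_strip hc0 hcb (by positivity) hu_diff hu_bdd (fun t => ?_) hwc.le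
    -- on the real axis: Paley–Wiener decay of `𝓕 (G t · e^{-ε·²})`
    have hslice : (fun x : ℝ => H x t * Complex.exp (-(ε : ℂ) * (x : ℂ) ^ 2)) =
        fun x : ℝ => G t x * Complex.exp (-(ε : ℂ) * (x : ℂ) ^ 2) := by
      funext x; rw [hGH]
    have hdec := norm_fourier_mul_gaussian_le_of_strip (κ := 0) (hGd t) hc0.le hcb hε
      (fun z hz => by simpa using hGM t z (hz.trans_lt hcb)) ξ
    have hJ' : (∫ x : ℝ, Real.exp (0 * |x| - ε * x ^ 2)) = J := by
      rw [hJ]; congr 1; funext x; congr 1; ring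
    rw [hJ'] at hdec
    have hexp : Real.exp (ε * c ^ 2) ≤ Real.exp (ε * b ^ 2) :=
      Real.exp_le_exp.2 (mul_le_mul_of_nonneg_left (pow_le_pow_left₀ hc0.le hcb.le 2) hε.le)
    calc ‖u t‖ = ‖𝓕 (fun x : ℝ => G t x * Complex.exp (-(ε : ℂ) * (x : ℂ) ^ 2)) ξ‖ := by
          simp only [hu, hslice]
      _ ≤ M * Real.exp (ε * c ^ 2) * J * Real.exp (-(2 * π * c * |ξ|)) := hdec
      _ ≤ M * Real.exp (ε * b ^ 2) * J * Real.exp (-(2 * π * c * |ξ|)) :=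
          mul_le_mul_of_nonneg_right (mul_le_mul_of_nonneg_right
            (mul_le_mul_of_nonneg_left hexp hM) hJ0) (Real.exp_pos _).le
      _ = K * Real.exp (-(2 * π * |ξ|) * c) := by rw [hK]; ring_nf
  exact le_mul_exp_of_forall_lt hw hc

end PartialFourier

/-! ### The Fourier–Laplace synthesis on the diamond -/

/-- **Holomorphy of the Fourier–Laplace integral on the diamond.** If `Ψ(ξ, ·)` is holomorphic
on the strip `{|Im w| < b}` for every `ξ`, `Ψ(·, w)` is continuous for every `w`, and
`‖Ψ(ξ, w)‖ ≤ A e^{-2π|ξ|(b - |Im w|)}`, then `(z, w) ↦ ∫ e^{2πiξz} Ψ(ξ, w) dξ` is (jointly)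
holomorphic on the diamond `{|Im z| + |Im w| < b}`: the integrand is jointly holomorphic and
dominated near each point by `A e^{-πδ|ξ|}`. [folklore] -/
theorem differentiableOn_fourierLaplace_diamond {Ψ : ℝ → ℂ → ℂ} {A : ℝ} (hA : 0 ≤ A)
    (hΨd : ∀ ξ, DifferentiableOn ℂ (Ψ ξ) {w : ℂ | |w.im| < b})
    (hΨc : ∀ w : ℂ, |w.im| < b → Continuous fun ξ => Ψ ξ w)
    (hΨb : ∀ ξ (w : ℂ), |w.im| < b → ‖Ψ ξ w‖ ≤ A * Real.exp (-(2 * π * |ξ|) * (b - |w.im|))) :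
    DifferentiableOn ℂ (fun p : ℂ × ℂ => ∫ ξ : ℝ, Complex.exp (2 * π * ξ * p.1 * I) * Ψ ξ p.2)
      {p : ℂ × ℂ | |p.1.im| + |p.2.im| < b} := by
  refine differentiableOn_integral_of_dominated (fun p hp => ?_) (Eventually.of_forall fun ξ => ?_)
    (fun p₀ hp₀ => ?_)
  · have hw : |p.2.im| < b := by
      simp only [mem_setOf_eq] at hp; linarith [abs_nonneg p.1.im]
    exact ((by fun_prop : Continuous fun ξ : ℝ => Complex.exp (2 * π * ξ * p.1 * I)).mul
      (hΨc p.2 hw)).aestronglyMeasurable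
  · refine DifferentiableOn.mul (by fun_prop) ((hΨd ξ).comp differentiableOn_snd fun p hp => ?_)
    simp only [mem_setOf_eq] at hp ⊢
    linarith [abs_nonneg p.1.im]
  · simp only [mem_setOf_eq] at hp₀
    set δ : ℝ := b - |p₀.1.im| - |p₀.2.im| with hδ
    have hδ0 : 0 < δ := by linarith
    refine ⟨δ / 4, by positivity, fun p hp => ?_, fun ξ => A * Real.exp (-(π * δ) * |ξ|),
      (integrable_exp_neg_mul_abs (by positivity)).const_mul A,
      Eventually.of_forall fun ξ p hp => ?_⟩
    · have h := abs_im_lt_of_mem_ball hp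
      simp only [mem_setOf_eq]
      linarith [h.1, h.2]
    · have h := abs_im_lt_of_mem_ball hp
      have hw : |p.2.im| < b := by linarith [h.1, h.2, abs_nonneg p.1.im]
      rw [norm_mul]
      calc ‖Complex.exp (2 * π * ξ * p.1 * I)‖ * ‖Ψ ξ p.2‖
          ≤ Real.exp (2 * π * |ξ| * |p.1.im|) * (A * Real.exp (-(2 * π * |ξ|) * (b - |p.2.im|))) :=
            mul_le_mul (norm_cexp_two_pi_mul_mul_I_le ξ p.1) (hΨb ξ p.2 hw) (norm_nonneg _)
              (Real.exp_pos _).le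
        _ = A * Real.exp (-(2 * π * |ξ|) * (b - |p.1.im| - |p.2.im|)) := by
            rw [mul_left_comm, ← Real.exp_add]; congr 2; ring
        _ ≤ A * Real.exp (-(π * δ) * |ξ|) := by
            refine mul_le_mul_of_nonneg_left (Real.exp_le_exp.2 ?_) hA
            have h1 : δ / 2 ≤ b - |p.1.im| - |p.2.im| := by linarith [h.1, h.2]
            have h3 := mul_le_mul_of_nonneg_left h1 (by positivity : (0 : ℝ) ≤ 2 * π * |ξ|)
            linarith

/-- **Bound for the Fourier–Laplace integral on the diamond**:
`‖∫ e^{2πiξz} Ψ(ξ, w) dξ‖ ≤ A ∫ e^{-2π(b - |Im z| - |Im w|)|ξ|} dξ`. [folklore] -/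
theorem norm_fourierLaplace_diamond_le {Ψ : ℝ → ℂ → ℂ} {A : ℝ}
    (hΨb : ∀ ξ (w : ℂ), |w.im| < b → ‖Ψ ξ w‖ ≤ A * Real.exp (-(2 * π * |ξ|) * (b - |w.im|)))
    {p : ℂ × ℂ} (hp : |p.1.im| + |p.2.im| < b) :
    ‖∫ ξ : ℝ, Complex.exp (2 * π * ξ * p.1 * I) * Ψ ξ p.2‖ ≤
      A * ∫ ξ : ℝ, Real.exp (-(2 * π * (b - |p.1.im| - |p.2.im|)) * |ξ|) := by
  have hw : |p.2.im| < b := by linarith [abs_nonneg p.1.im]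
  have hδ : 0 < b - |p.1.im| - |p.2.im| := by linarith
  rw [← integral_const_mul]
  refine norm_integral_le_of_norm_le ((integrable_exp_neg_mul_abs (by positivity)).const_mul A)
    (Eventually.of_forall fun ξ => ?_)
  rw [norm_mul]
  calc ‖Complex.exp (2 * π * ξ * p.1 * I)‖ * ‖Ψ ξ p.2‖
      ≤ Real.exp (2 * π * |ξ| * |p.1.im|) * (A * Real.exp (-(2 * π * |ξ|) * (b - |p.2.im|))) :=
        mul_le_mul (norm_cexp_two_pi_mul_mul_I_le ξ p.1) (hΨb ξ p.2 hw) (norm_nonneg _)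
          (Real.exp_pos _).le
    _ = A * Real.exp (-(2 * π * (b - |p.1.im| - |p.2.im|)) * |ξ|) := by
        rw [mul_left_comm, ← Real.exp_add]; congr 2; ring

/-- The inverse Fourier transform on `ℝ` as an exponential integral with the kernel
`e^{2πiξx}`. [folklore] -/
theorem fourierInv_real_eq_integral_cexp_mul (f : ℝ → ℂ) (x : ℝ) :
    𝓕⁻ f x = ∫ ξ : ℝ, Complex.exp (2 * π * ξ * (x : ℂ) * I) * f ξ := by
  rw [Real.fourierInv_eq_fourier_neg, Real.fourier_real_eq_integral_exp_smul]
  refine integral_congr_ae (Eventually.of_forall fun ξ => ?_)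
  simp only [smul_eq_mul]
  congr 2
  push_cast
  ring

/-! ### The extension with a bound linear in `M` -/

/-- **The holomorphic extension to the diamond, with a non-sharp bound linear in `M`.** Given the
two bounded holomorphic slice families `G y` (first variable) and `H x` (second variable) on the
strip `{|Im| < b}`, consistent on `ℝ²` (`G y x = H x y`), the function
`Φ(z, w) = e^{εz²} ∫ e^{2πiξz} 𝓕(x ↦ H x w e^{-εx²})(ξ) dξ` is holomorphic on the diamond
`{|Im z| + |Im w| < b}`, restricts to `H x y` at real points (Fourier inversion), and satisfies
`‖Φ(p)‖ ≤ C(p) M` with `C(p)` depending only on `ε, b, p`. [folklore] -/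
theorem exists_extension_diamond_aux {ε : ℝ} (hb : 0 < b) (hε : 0 < ε) :
    ∃ C : ℂ × ℂ → ℝ, ∀ (M : ℝ) (G H : ℝ → ℂ → ℂ), 0 ≤ M →
      (∀ y, DifferentiableOn ℂ (G y) {z : ℂ | |z.im| < b}) →
      (∀ y (z : ℂ), |z.im| < b → ‖G y z‖ ≤ M) →
      (∀ x, DifferentiableOn ℂ (H x) {w : ℂ | |w.im| < b}) →
      (∀ x (w : ℂ), |w.im| < b → ‖H x w‖ ≤ M) → (∀ x y : ℝ, G y x = H x y) →
      ∃ Φ : ℂ × ℂ → ℂ, DifferentiableOn ℂ Φ {p : ℂ × ℂ | |p.1.im| + |p.2.im| < b} ∧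
        (∀ p : ℂ × ℂ, |p.1.im| + |p.2.im| < b → ‖Φ p‖ ≤ C p * M) ∧
        ∀ x y : ℝ, Φ ((x : ℂ), (y : ℂ)) = H x y := by
  refine ⟨fun p => ‖Complex.exp ((ε : ℂ) * p.1 ^ 2)‖ *
    ((Real.exp (ε * b ^ 2) * ∫ x : ℝ, Real.exp (-ε * x ^ 2)) *
      ∫ ξ : ℝ, Real.exp (-(2 * π * (b - |p.1.im| - |p.2.im|)) * |ξ|)),
    fun M G H hM hGd hGM hHd hHM hGH => ?_⟩
  -- Step 1: parameter continuity of the transverse family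
  have hHc0 : ∀ y : ℝ, Continuous fun x => H x y := fun y => by
    have h : Continuous fun x : ℝ => G y x :=
      (hGd y).continuousOn.comp_continuous Complex.continuous_ofReal
        (ofReal_mem_setOf_abs_im_lt hb)
    exact h.congr fun x => hGH x y
  have hHc : ∀ w : ℂ, |w.im| < b → Continuous fun x => H x w := fun w hw =>
    continuous_apply_of_continuous_ofReal hb hHd hHM hHc0 hw
  -- Step 2/3: the partial Fourier transform and its decay on the strip
  set A : ℝ := (Real.exp (ε * b ^ 2) * ∫ x : ℝ, Real.exp (-ε * x ^ 2)) * M with hA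
  set Ψ : ℝ → ℂ → ℂ := fun ξ w =>
    𝓕 (fun x : ℝ => H x w * Complex.exp (-(ε : ℂ) * (x : ℂ) ^ 2)) ξ with hΨ
  have hA0 : 0 ≤ A := by
    have : 0 ≤ ∫ x : ℝ, Real.exp (-ε * x ^ 2) := integral_nonneg fun x => (Real.exp_pos _).le
    positivity
  have hΨd : ∀ ξ, DifferentiableOn ℂ (Ψ ξ) {w : ℂ | |w.im| < b} := fun ξ =>
    differentiableOn_fourier_slice hε hHd hHM hHc ξ
  have hΨc : ∀ w : ℂ, |w.im| < b → Continuous fun ξ => Ψ ξ w := fun w hw =>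
    continuous_fourier_slice hε (hHc w hw) (fun x => hHM x w hw)
  have hΨb : ∀ ξ (w : ℂ), |w.im| < b → ‖Ψ ξ w‖ ≤ A * Real.exp (-(2 * π * |ξ|) * (b - |w.im|)) :=
    fun ξ w hw => norm_fourier_slice_le_exp hb hε hM hHd hHM hHc hGd hGM hGH ξ hw
  -- Step 4: the Fourier–Laplace synthesis
  refine ⟨fun p => Complex.exp ((ε : ℂ) * p.1 ^ 2) *
      ∫ ξ : ℝ, Complex.exp (2 * π * ξ * p.1 * I) * Ψ ξ p.2, ?_, fun p hp => ?_, fun x y => ?_⟩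
  · exact DifferentiableOn.mul (by fun_prop) (differentiableOn_fourierLaplace_diamond hA0 hΨd hΨc hΨb)
  · dsimp only
    rw [norm_mul, mul_assoc]
    refine mul_le_mul_of_nonneg_left ?_ (norm_nonneg _)
    calc ‖∫ ξ : ℝ, Complex.exp (2 * π * ξ * p.1 * I) * Ψ ξ p.2‖
        ≤ A * ∫ ξ : ℝ, Real.exp (-(2 * π * (b - |p.1.im| - |p.2.im|)) * |ξ|) :=
          norm_fourierLaplace_diamond_le hΨb hp
      _ = _ := by rw [hA]; ring
  · -- real points: Fourier inversion for the continuous integrable slice `x ↦ H x y e^{-εx²}`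
    have hyS : |((y : ℂ)).im| < b := by simpa using hb
    have hcont : Continuous fun x : ℝ => H x y * Complex.exp (-(ε : ℂ) * (x : ℂ) ^ 2) :=
      (hHc0 y).mul (by fun_prop)
    have hint : Integrable fun x : ℝ => H x y * Complex.exp (-(ε : ℂ) * (x : ℂ) ^ 2) :=
      integrable_mul_cexp_neg_mul_sq hε (hHc0 y) fun x => hHM x y hyS
    have hFint : Integrable (𝓕 fun x : ℝ => H x y * Complex.exp (-(ε : ℂ) * (x : ℂ) ^ 2)) := by
      refine Integrable.mono' ((integrable_exp_neg_mul_abs (by positivity : 0 < 2 * π * b)).const_mul A)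
        (hΨc y hyS).aestronglyMeasurable (Eventually.of_forall fun ξ => ?_)
      have h := hΨb ξ y hyS
      simp only [hΨ, ofReal_im, abs_zero, sub_zero] at h
      calc _ ≤ A * Real.exp (-(2 * π * |ξ|) * b) := h
        _ = A * Real.exp (-(2 * π * b) * |ξ|) := by ring_nf
    have hinv := congr_fun (hcont.fourierInv_fourier_eq hint hFint) x
    rw [fourierInv_real_eq_integral_cexp_mul] at hinv
    show Complex.exp ((ε : ℂ) * (x : ℂ) ^ 2) *
      (∫ ξ : ℝ, Complex.exp (2 * π * ξ * (x : ℂ) * I) * Ψ ξ y) = H x y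
    rw [hinv, cexp_mul_sq_mul_mul_cexp_neg]

/-! ### Uniqueness on the diamond and the sharp bound -/

/-- **Uniqueness of the extension**: two functions holomorphic on the diamond
`{|Im z| + |Im w| < b}` which agree at all real points agree on the diamond (identity theorem in
`z` on the slices `w = y ∈ ℝ`, then in `w` on the slices `z = const`). [folklore] -/
theorem eqOn_diamond_of_forall_ofReal (hb : 0 < b) {G₁ G₂ : ℂ × ℂ → ℂ}
    (h₁ : DifferentiableOn ℂ G₁ {p : ℂ × ℂ | |p.1.im| + |p.2.im| < b})
    (h₂ : DifferentiableOn ℂ G₂ {p : ℂ × ℂ | |p.1.im| + |p.2.im| < b})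
    (h : ∀ x y : ℝ, G₁ ((x : ℂ), (y : ℂ)) = G₂ ((x : ℂ), (y : ℂ))) :
    EqOn G₁ G₂ {p : ℂ × ℂ | |p.1.im| + |p.2.im| < b} := by
  -- first variable, on the real slices `w = y`
  have hslice1 : ∀ (y : ℝ) (z : ℂ), |z.im| < b → G₁ (z, y) = G₂ (z, y) := by
    intro y
    have hmaps : MapsTo (fun z : ℂ => (z, (y : ℂ))) {z : ℂ | |z.im| < b}
        {p : ℂ × ℂ | |p.1.im| + |p.2.im| < b} := fun z hz => by simpa using hz
    have hd : ∀ {G : ℂ × ℂ → ℂ}, DifferentiableOn ℂ G {p : ℂ × ℂ | |p.1.im| + |p.2.im| < b} →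
        DifferentiableOn ℂ (fun z : ℂ => G (z, (y : ℂ))) {z : ℂ | |z.im| < b} := fun hG =>
      hG.comp (differentiableOn_id.prodMk (differentiableOn_const _)) hmaps
    exact fun z hz => eqOn_setOf_abs_im_lt_of_forall_ofReal hb (hd h₁) (hd h₂) (fun t => h t y) hz
  -- second variable, on the slices `z = const`
  rintro ⟨z, w⟩ hp
  simp only [mem_setOf_eq] at hp
  have hb' : 0 < b - |z.im| := by linarith [abs_nonneg w.im]
  have hmaps : MapsTo (fun w' : ℂ => (z, w')) {w' : ℂ | |w'.im| < b - |z.im|}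
      {p : ℂ × ℂ | |p.1.im| + |p.2.im| < b} := fun w' hw' => by
    simp only [mem_setOf_eq] at hw' ⊢; linarith
  have hd : ∀ {G : ℂ × ℂ → ℂ}, DifferentiableOn ℂ G {p : ℂ × ℂ | |p.1.im| + |p.2.im| < b} →
      DifferentiableOn ℂ (fun w' : ℂ => G (z, w')) {w' : ℂ | |w'.im| < b - |z.im|} := fun hG =>
    hG.comp ((differentiableOn_const _).prodMk differentiableOn_id) hmaps
  have hz : |z.im| < b := by linarith [abs_nonneg w.im]
  exact eqOn_setOf_abs_im_lt_of_forall_ofReal hb' (hd h₁) (hd h₂)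
    (fun t => hslice1 t z hz) (show |w.im| < b - |z.im| by linarith)

/-- **The power trick**: if `r^{n+1} ≤ C M^{n+1}` for all `n` with `M ≥ 0`, then `r ≤ M`.
[folklore] -/
theorem le_of_forall_pow_succ_le {r C M : ℝ} (hM : 0 ≤ M)
    (h : ∀ n : ℕ, r ^ (n + 1) ≤ C * M ^ (n + 1)) : r ≤ M := by
  by_contra hlt
  rw [not_le] at hlt
  have hr : 0 < r := hM.trans_lt hlt
  have hq0 : 0 ≤ M / r := div_nonneg hM hr.le
  have hq1 : M / r < 1 := (div_lt_one hr).2 hlt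
  have hone : ∀ n : ℕ, (1 : ℝ) ≤ C * (M / r) ^ (n + 1) := fun n => by
    have hrn : 0 < r ^ (n + 1) := pow_pos hr _
    rw [div_pow, mul_div_assoc', le_div_iff₀ hrn, one_mul]
    exact h n
  have hlim : Tendsto (fun n : ℕ => C * (M / r) ^ (n + 1)) atTop (𝓝 (C * 0)) :=
    ((tendsto_pow_atTop_nhds_zero_of_lt_one hq0 hq1).comp (tendsto_add_atTop_nat 1)).const_mul C
  rw [mul_zero] at hlim
  have := ge_of_tendsto' hlim hone
  linarith

/-- **The bounded cross theorem for two strips** (Bernstein 1912 / Siciak 1969 / Zahariuta 1976;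
Jarnicki–Pflug, *Separately Analytic Functions*, Ch. 5, with the relative extremal function
`h_{ℝ,S_b}(z) = |Im z|/b`). A function `F` of two real variables which for every real `y` is the
restriction of a function holomorphic and bounded by `M` on the strip `{|Im z| < b}`, and for
every real `x` likewise in the second variable, is the restriction of ONE function holomorphic on
the diamond tube `{|Im z| + |Im w| < b}` and bounded by `M` there. The extension is the
Fourier–Laplace synthesis of `exists_extension_diamond_aux`; the sharp bound `M` follows from the
non-sharp bound `C(p) M` applied to the powers `F^N` (whose extensions are the powers of the
extension, by uniqueness) and `N → ∞`.
[cite: JarnickiPflug2011, Ch. 5 (classical cross theorem with estimate)] -/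
theorem exists_holomorphic_extension_diamond_of_separately {M : ℝ} {F : ℝ → ℝ → ℂ} (hb : 0 < b)
    (hg : ∀ y : ℝ, ∃ g : ℂ → ℂ, DifferentiableOn ℂ g {z : ℂ | |z.im| < b} ∧
      (∀ z : ℂ, |z.im| < b → ‖g z‖ ≤ M) ∧ ∀ x : ℝ, g x = F x y)
    (hh : ∀ x : ℝ, ∃ h : ℂ → ℂ, DifferentiableOn ℂ h {w : ℂ | |w.im| < b} ∧
      (∀ w : ℂ, |w.im| < b → ‖h w‖ ≤ M) ∧ ∀ y : ℝ, h y = F x y) :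
    ∃ G : ℂ × ℂ → ℂ, DifferentiableOn ℂ G {p : ℂ × ℂ | |p.1.im| + |p.2.im| < b} ∧
      (∀ p : ℂ × ℂ, |p.1.im| + |p.2.im| < b → ‖G p‖ ≤ M) ∧
      ∀ x y : ℝ, G ((x : ℂ), (y : ℂ)) = F x y := by
  choose g hgd hgM hgF using hg
  choose h hhd hhM hhF using hh
  have hM : 0 ≤ M := (norm_nonneg _).trans (hgM 0 0 (by simpa using hb))
  have hGH : ∀ x y : ℝ, g y x = h x y := fun x y => by rw [hgF, hhF]
  -- the extension (ε = 1), with a bound `C(p) M` linear in `M`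
  obtain ⟨C, hC⟩ := exists_extension_diamond_aux hb one_pos
  obtain ⟨Φ, hΦd, hΦb, hΦr⟩ := hC M g h hM hgd hgM hhd hhM hGH
  refine ⟨Φ, hΦd, fun p hp => ?_, fun x y => by rw [hΦr, hhF]⟩
  -- the power trick: the extension of `F^(n+1)` is `Φ^(n+1)`
  refine le_of_forall_pow_succ_le hM (C := C p) fun n => ?_
  obtain ⟨Φn, hΦnd, hΦnb, hΦnr⟩ := hC (M ^ (n + 1)) (fun y z => g y z ^ (n + 1))
    (fun x w => h x w ^ (n + 1)) (pow_nonneg hM (n + 1))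
    (fun y => (hgd y).pow _) (fun y z hz => by
      rw [norm_pow]; exact pow_le_pow_left₀ (norm_nonneg _) (hgM y z hz) _)
    (fun x => (hhd x).pow _) (fun x w hw => by
      rw [norm_pow]; exact pow_le_pow_left₀ (norm_nonneg _) (hhM x w hw) _)
    (fun x y => by simp only [hGH])
  have heq : EqOn Φn (fun p => Φ p ^ (n + 1)) {p : ℂ × ℂ | |p.1.im| + |p.2.im| < b} :=
    eqOn_diamond_of_forall_ofReal hb hΦnd (hΦd.pow _) fun x y => by
      simp only [hΦnr, hΦr]
  have h1 := hΦnb p hp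
  rw [heq hp, norm_pow] at h1
  exact h1

end Literature.Analysis.Complex

end
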